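import Literature.Probability.Percolation.PlanarDuality
import HarnessLib

/-!
# The `∗`-adjacency of `ℤ²` and the matching-lattice crossing lemma

Topic `Probability/LatticeModels` (planar lattice combinatorics of `ℤ²`). Georgii–Higuchi 2000, §2
(p. 4): "We also need to work with the conjugate graph structure on `ℤ²`, for which two points are
considered as neighbors if their Euclidean distance is either `1` or `√2`, i.e., if they are either
nearest neighbors or diagonal neighbors. This graph structure is indicated by a star and leads to
the concepts of `∗`paths, `∗`circuits, … Note that each path is a fortiori a `∗`path." The pair
(`ℤ²`, `ℤ²*`) is a matching pair of lattices (Kesten 1982, §2.2): a nearest-neighbour crossing of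
a rectangle in one direction and a `∗`-crossing in the other direction always meet. This file
provides

* `zdStarGraph` — the `∗`-graph on `ℤ²` (sup-norm distance `1`), with `zdGraph 2 ≤ zdStarGraph`;
* `walkWinding_eq_of_starWalk` — the winding number of a lattice walk `p` (`PlanarDuality.lean`)
  is constant along `∗`-walks avoiding the vertices of `p`: a diagonal step is the composite of two
  lattice steps across edges that contain an endpoint of the diagonal and hence are not edges of
  `p` (the tree's edge-level invariance `walkWinding_eq_walkWinding_right/up`);
* **`exists_mem_support_of_crossing_star`** — a left–right lattice crossing and a bottom–top
  `∗`-crossing of a rectangle have a common vertex (the proof of the tree's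
  `exists_mem_support_of_crossing` verbatim, with the `∗`-constancy lemma).

## References

* H.-O. Georgii, Y. Higuchi, J. Math. Phys. 41 (2000), §2 p. 4 (`∗`-notions) [GeorgiiHiguchi2000].
* H. Kesten, *Percolation theory for mathematicians* (1982), §2.2 (matching pairs, crossings),
  as formalised in `PlanarDuality.lean` [KestenPTM1982].
-/

noncomputable section

open SimpleGraph
open Literature.Probability.Percolation

namespace Literature.Probability.LatticeModels

/-! ### The `∗`-graph -/

/-- The **`∗`-graph** (conjugate / matching graph) of `ℤ²`: distinct sites at sup-norm distance `1`
are adjacent — nearest neighbours and diagonal neighbours (Georgii–Higuchi 2000, §2 p. 4). [cite: GeorgiiHiguchi2000, §2 p. 4] -/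
def zdStarGraph : SimpleGraph (Site 2) where
  Adj x y := x ≠ y ∧ ∀ i, |x i - y i| ≤ 1
  symm := ⟨fun _ _ h => ⟨h.1.symm, fun i => by rw [abs_sub_comm]; exact h.2 i⟩⟩
  loopless := ⟨fun _ h => h.1 rfl⟩

/-- Adjacency in the `∗`-graph. [cite: GeorgiiHiguchi2000, §2 p. 4] -/
theorem zdStarGraph_adj {x y : Site 2} : zdStarGraph.Adj x y ↔ x ≠ y ∧ ∀ i, |x i - y i| ≤ 1 :=
  Iff.rfl

/-- Adjacency in the `∗`-graph in coordinates. [cite: GeorgiiHiguchi2000, §2 p. 4] -/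
theorem zdStarGraph_adj_iff {x y : Site 2} :
    zdStarGraph.Adj x y ↔ (x 0 ≠ y 0 ∨ x 1 ≠ y 1) ∧ |x 0 - y 0| ≤ 1 ∧ |x 1 - y 1| ≤ 1 := by
  rw [zdStarGraph_adj, Ne, Site.eq_iff_two, not_and_or, Fin.forall_fin_two]

/-- **"Each path is a fortiori a `∗`path"**: nearest neighbours are `∗`-neighbours. [cite: GeorgiiHiguchi2000, §2 p. 4] -/
theorem zdGraph_le_zdStarGraph : zdGraph 2 ≤ zdStarGraph := by
  intro x y h
  rw [zdStarGraph_adj_iff]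
  rcases stepKind_of_adj h with ⟨h0, h1⟩ | ⟨h0, h1⟩ | ⟨h1, h0⟩ | ⟨h1, h0⟩ <;>
    refine ⟨by omega, ?_, ?_⟩ <;> rw [abs_le] <;> omega

/-- The `∗`-graph is locally finite: the neighbours of `x` lie in the `3 × 3` block around `x`. [folklore] -/
instance zdStarGraph.instLocallyFinite : zdStarGraph.LocallyFinite := by
  intro x
  refine Set.Finite.fintype ((Set.Finite.pi' (t := fun i : Fin 2 => Set.Icc (x i - 1) (x i + 1))
    fun i => Set.finite_Icc _ _).subset ?_)
  intro y hy
  rw [mem_neighborSet, zdStarGraph_adj] at hy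
  simp only [Set.mem_setOf_eq]
  intro i
  have := hy.2 i
  rw [abs_le] at this
  exact ⟨by linarith, by linarith⟩

/-- Adjacency in the `∗`-graph is decidable (classically). [folklore] -/
instance : DecidableRel zdStarGraph.Adj := fun _ _ => Classical.dec _

/-- The eight kinds of unit `∗`-steps `x → y`, in coordinates. [folklore] -/
inductive StarStepKind (x y : Site 2) : Prop
  | lattice (h : StepKind x y) : StarStepKind x y
  | upRight (h0 : y 0 = x 0 + 1) (h1 : y 1 = x 1 + 1) : StarStepKind x y
  | upLeft (h0 : x 0 = y 0 + 1) (h1 : y 1 = x 1 + 1) : StarStepKind x y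
  | downRight (h0 : y 0 = x 0 + 1) (h1 : x 1 = y 1 + 1) : StarStepKind x y
  | downLeft (h0 : x 0 = y 0 + 1) (h1 : x 1 = y 1 + 1) : StarStepKind x y

/-- `∗`-adjacency in coordinates: the eight unit steps. [folklore] -/
theorem starStepKind_of_adj {x y : Site 2} (h : zdStarGraph.Adj x y) : StarStepKind x y := by
  rw [zdStarGraph_adj_iff] at h
  obtain ⟨hne, h0, h1⟩ := h
  rw [abs_le] at h0 h1
  rcases lt_trichotomy (x 0) (y 0) with hx | hx | hx <;>
    rcases lt_trichotomy (x 1) (y 1) with hy | hy | hy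
  · exact .upRight (by omega) (by omega)
  · exact .lattice (.right (by omega) (by omega))
  · exact .downRight (by omega) (by omega)
  · exact .lattice (.up (by omega) (by omega))
  · exact absurd hy (by rcases hne with h | h <;> omega)
  · exact .lattice (.down (by omega) (by omega))
  · exact .upLeft (by omega) (by omega)
  · exact .lattice (.left (by omega) (by omega))
  · exact .downLeft (by omega) (by omega)

/-! ### Winding numbers are constant along avoiding `∗`-walks -/

section Winding

variable {a b : Site 2}

/-- One diagonal step `v → v + e₀ + e₁` off the walk does not change the winding number (compose
`v → v + e₀ → v + e₀ + e₁`; the two crossed edges contain the endpoint `v + e₀ + e₁ ∉ p`). [folklore] -/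
theorem walkWinding_eq_upRight {p : (zdGraph 2).Walk a b} {v : Site 2}
    (hv' : v + Pi.single 0 1 + Pi.single 1 1 ∉ p.support)
    (ha : a ∉ rayAbove (v + Pi.single 0 1)) (hb : b ∉ rayAbove (v + Pi.single 0 1)) :
    walkWinding p v = walkWinding p (v + Pi.single 0 1 + Pi.single 1 1) := by
  have h1 : walkWinding p v = walkWinding p (v + Pi.single 0 1) :=
    walkWinding_eq_walkWinding_right fun he => hv' (Walk.snd_mem_support_of_mem_edges p he)
  have h2 : walkWinding p (v + Pi.single 0 1) = walkWinding p (v + Pi.single 0 1 + Pi.single 1 1) :=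
    walkWinding_eq_walkWinding_up (fun he => hv' (Walk.fst_mem_support_of_mem_edges p he)) ha hb
  exact h1.trans h2

/-- One diagonal step `v + e₁ → v + e₀` (down-right) off the walk does not change the winding number
(compose `v + e₁ → v → v + e₀` backwards: both crossed edges contain `v + e₁` or `v + e₀`). [folklore] -/
theorem walkWinding_eq_downRight {p : (zdGraph 2).Walk a b} {v : Site 2}
    (hv1 : v + Pi.single 1 1 ∉ p.support) (hv0 : v + Pi.single 0 1 ∉ p.support)
    (ha : a ∉ rayAbove v) (hb : b ∉ rayAbove v) :
    walkWinding p (v + Pi.single 1 1) = walkWinding p (v + Pi.single 0 1) := by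
  have h1 : walkWinding p v = walkWinding p (v + Pi.single 1 1) :=
    walkWinding_eq_walkWinding_up (fun he => hv1 (Walk.fst_mem_support_of_mem_edges p he)) ha hb
  have h2 : walkWinding p v = walkWinding p (v + Pi.single 0 1) :=
    walkWinding_eq_walkWinding_right fun he => hv0 (Walk.fst_mem_support_of_mem_edges p he)
  exact h1.symm.trans h2

/-- The winding number of a lattice walk is constant along `∗`-steps avoiding the walk (when the
endpoints of the walk are off the half-lines through the step and just below it). [folklore] -/
theorem walkWinding_eq_of_starStepKind {p : (zdGraph 2).Walk a b} {v v' : Site 2}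
    (hvv' : StarStepKind v v') (hv : v ∉ p.support) (hv' : v' ∉ p.support)
    (hav : a ∉ rayAbove v) (hbv : b ∉ rayAbove v) (hav' : a ∉ rayAbove v') (hbv' : b ∉ rayAbove v')
    (hav₁ : a ∉ rayAbove (v - Pi.single 1 1)) (hbv₁ : b ∉ rayAbove (v - Pi.single 1 1))
    (hav'₁ : a ∉ rayAbove (v' - Pi.single 1 1)) (hbv'₁ : b ∉ rayAbove (v' - Pi.single 1 1)) :
    walkWinding p v = walkWinding p v' := by
  rcases hvv' with h | ⟨h0, h1⟩ | ⟨h0, h1⟩ | ⟨h0, h1⟩ | ⟨h0, h1⟩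
  · exact walkWinding_eq_of_stepKind h hv hv' hav hbv hav' hbv'
  · -- `v' = v + e₀ + e₁`
    have hv'eq : v' = v + Pi.single 0 1 + Pi.single 1 1 := by
      simp [Site.eq_iff_two, h0, h1]
    have hmid : v + Pi.single 0 1 = v' - Pi.single 1 1 := by
      simp [Site.eq_iff_two, h0, h1]
    rw [hv'eq]
    refine walkWinding_eq_upRight (by rwa [← hv'eq]) ?_ ?_ <;> rw [hmid]
    · exact hav'₁
    · exact hbv'₁
  · -- `v = v' + e₀ - e₁`, i.e. `v' = w + e₁`, `v = w + e₀` with `w = v - e₀`... use `w = v' - e₁`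
    set w := v' - Pi.single 1 1 with hw
    have hv'eq : v' = w + Pi.single 1 1 := by simp [hw]
    have hveq : v = w + Pi.single 0 1 := by
      simp [Site.eq_iff_two, hw, h0, h1]
    rw [hv'eq, hveq]
    exact (walkWinding_eq_downRight (by rwa [← hv'eq]) (by rwa [← hveq]) hav'₁ hbv'₁).symm
  · -- `v' = v + e₀ - e₁`: `v = w + e₁`, `v' = w + e₀` with `w = v - e₁`
    set w := v - Pi.single 1 1 with hw
    have hveq : v = w + Pi.single 1 1 := by simp [hw]
    have hv'eq : v' = w + Pi.single 0 1 := by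
      simp [Site.eq_iff_two, hw, h0, h1]
    rw [hv'eq, hveq]
    exact walkWinding_eq_downRight (by rwa [← hveq]) (by rwa [← hv'eq]) hav₁ hbv₁
  · -- `v = v' + e₀ + e₁`
    have hveq : v = v' + Pi.single 0 1 + Pi.single 1 1 := by
      simp [Site.eq_iff_two, h0, h1]
    have hmid : v' + Pi.single 0 1 = v - Pi.single 1 1 := by
      simp [Site.eq_iff_two, h0, h1]
    rw [hveq]
    refine (walkWinding_eq_upRight (by rwa [← hveq]) ?_ ?_).symm <;> rw [hmid]
    · exact hav₁
    · exact hbv₁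

/-- **Constancy along avoiding `∗`-walks.** If a `∗`-walk `q` avoids the vertices of the lattice
walk `p` (and the endpoints of `p` are off the half-lines `rayAbove z` and `rayAbove (z - e₁)`,
`z ∈ q`), then `p` winds equally around the two ends of `q` (Kesten 1982, §2.2: the matching
property of the pair `(ℤ², ℤ²*)`). [folklore] -/
theorem walkWinding_eq_of_starWalk (p : (zdGraph 2).Walk a b) {c d : Site 2}
    (q : zdStarGraph.Walk c d) (hq : ∀ z ∈ q.support, z ∉ p.support)
    (ha : ∀ z ∈ q.support, a ∉ rayAbove z ∧ a ∉ rayAbove (z - Pi.single 1 1))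
    (hb : ∀ z ∈ q.support, b ∉ rayAbove z ∧ b ∉ rayAbove (z - Pi.single 1 1)) :
    walkWinding p c = walkWinding p d := by
  induction q with
  | nil => rfl
  | cons h q ih =>
    rename_i x y z
    have hx : x ∈ (Walk.cons h q).support := by simp
    have hy : y ∈ (Walk.cons h q).support := by simp
    have htail : ∀ w ∈ q.support, w ∈ (Walk.cons h q).support := fun w hw => by simp [hw]
    rw [walkWinding_eq_of_starStepKind (starStepKind_of_adj h) (hq x hx) (hq y hy) (ha x hx).1
      (hb x hx).1 (ha y hy).1 (hb y hy).1 (ha x hx).2 (hb x hx).2 (ha y hy).2 (hb y hy).2]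
    exact ih (fun w hw => hq w (htail w hw)) (fun w hw => ha w (htail w hw))
      (fun w hw => hb w (htail w hw))

end Winding

/-! ### A lattice crossing and a transversal `∗`-crossing of a rectangle meet -/

section Meet

variable {a b c d : Site 2}

/-- **A left–right lattice crossing and a bottom–top `∗`-crossing of a rectangle meet** (the
matching property of `(ℤ², ℤ²*)`, Kesten 1982, §2.2; this is why a `+`path and a `-∗`path cannot
cross, Georgii–Higuchi 2000, §2). If `P` is a lattice walk in the box `[L, R] × [B, T]` from the
left side to the right side and `Q` a `∗`-walk in the same box from the bottom side to the top
side, then `P` and `Q` have a common vertex. Proof: that of `exists_mem_support_of_crossing`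
(winding number of the extended `P`: `0` at the top, `-1` just below the bottom, constant along
the `∗`-walk `Q` if it avoided `P`). [cite: GeorgiiHiguchi2000, §2 p. 4] -/
theorem exists_mem_support_of_crossing_star {L R B T : ℤ}
    (P : (zdGraph 2).Walk a b) (Q : zdStarGraph.Walk c d)
    (hP : ∀ z ∈ P.support, L ≤ z 0 ∧ z 0 ≤ R ∧ B ≤ z 1 ∧ z 1 ≤ T)
    (hQ : ∀ z ∈ Q.support, L ≤ z 0 ∧ z 0 ≤ R ∧ B ≤ z 1 ∧ z 1 ≤ T)
    (ha : a 0 = L) (hb : b 0 = R) (hc : c 1 = B) (hd : d 1 = T) :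
    ∃ z ∈ P.support, z ∈ Q.support := by
  by_contra hdis
  push Not at hdis
  have hbN := hP b (Walk.end_mem_support P)
  have hP' : ∀ z ∈ P.support, B ≤ z 1 ∧ z 1 ≤ T := fun z hz => ⟨(hP z hz).2.2.1, (hP z hz).2.2.2⟩
  -- extend `Q` at the start by one step up from `c - e₁`
  set c' := c - Pi.single 1 1 with hc'
  have hadj' : zdStarGraph.Adj c' c :=
    zdGraph_le_zdStarGraph (adj_of_stepKind (.up (by simp [hc']) (by simp [hc'])))
  have hc0 := hQ c (Walk.start_mem_support Q)
  -- the winding number of the extended `P` at the top end `d` of `Q` is `0`, at `c'` it is `-1`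
  have hWd : walkWinding (extendRight P B) d = 0 := walkWinding_extendRight_top hP' hd
  have hWc : walkWinding (extendRight P B) c' = -1 :=
    walkWinding_extendRight_bottom hP' (by simp [hc', hc]) (by simp [hc', hb]; omega)
  -- but the winding number is constant along `c' :: Q`
  have hend := extendRight_end_apply b hbN.2.2.1
  have hconst := walkWinding_eq_of_starWalk (extendRight P B) (Walk.cons hadj' Q) ?_ ?_ ?_
  · rw [hWc, hWd] at hconst; exact absurd hconst (by norm_num)
  · intro z hz hzP
    rw [Walk.support_cons, List.mem_cons] at hz
    rcases mem_support_extendRight hbN.2.2.1 hzP with hzP | hzP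
    · rcases hz with rfl | hz
      · have := (hP _ hzP).2.2.1
        simp [hc'] at this
        omega
      · exact hdis z hzP hz
    · rcases hz with rfl | hz
      · simp [hc'] at hzP
        omega
      · have := (hQ z hz).2.1
        omega
  · intro z hz
    rw [Walk.support_cons, List.mem_cons] at hz
    simp only [mem_rayAbove, ha, not_and, not_le, Pi.sub_apply, single_one_apply_zero, sub_zero]
    rcases hz with rfl | hz
    · simp only [hc', Pi.sub_apply, single_one_apply_zero, sub_zero]
      have := hc0.1
      exact ⟨fun _ => by omega, fun _ => by omega⟩
    · have := (hQ z hz).1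
      exact ⟨fun _ => by omega, fun _ => by omega⟩
  · intro z hz
    rw [Walk.support_cons, List.mem_cons] at hz
    simp only [mem_rayAbove, not_and, Pi.sub_apply, single_one_apply_one, single_one_apply_zero,
      sub_zero]
    rw [hend.2]
    rcases hz with rfl | hz
    · simp only [hc', Pi.sub_apply, single_one_apply_one, hc]
      exact ⟨fun h => by omega, fun h => by omega⟩
    · have := (hQ z hz).2.2.1
      exact ⟨fun h => by omega, fun h => by omega⟩

end Meet

end Literature.Probability.LatticeModels
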